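import Summits.ValiantsHypothesis.ValiantsHypothesis.Theses.DivisionGap
import Summits.ValiantsHypothesis.ValiantsHypothesis.Theorems.DivisionGapDefs
import Summits.ValiantsHypothesis.ValiantsHypothesis.Theorems.DivisionGapPerDivisionHardSparseFibre
import Summits.ValiantsHypothesis.ValiantsHypothesis.Theorems.DivisionGapPerDivisionHardStubDecidedAtoms
import Summits.ValiantsHypothesis.ValiantsHypothesis.Theorems.DivisionGapPerDivisionHardStubSigmaPiSigmaPiCount

/-!
# Crux `DivisionGap.PerDivisionHard` (stmt-ValiantsHypothesis-5065) — the `ΣΠΣΠ` RUNG (depth four over a decided atom pool)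

`PerDivisionHard` asks, for every `c` and all large `n`, that every nonzero cofactor
`h ∈ ℝ≥0[x_ij]` satisfies `2^{(log₂ n + c)^c} < L(per_n · h) + L(h)`.  This file proves it for every
nonzero `ΣΠΣΠ` EXPRESSION over a common pool of torus-homogeneous atoms `F_β`
(`IsTorusHomogeneous`: all monomials of the atom share row and column margins),
`h = Σ_{l∈L} a_l · x^{C_l} · ∏_{γ∈J} (Σ_{l'∈L'_γ} a'_{γ,l'} · x^{C'_{γ,l'}} · ∏_{β∈I} F_β^{μ_{γ,l',β}})^{ν_{l,γ}}`,
with `Σ_β |supp F_β|² ≤ 2^{⌊√n⌋/(log₂ n + e)^e}` (`e` absolute) and the crude fibre count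
`Σ_l ∏_γ |L'_γ|^{ν_{l,γ}} ≤ 2^{(log₂ n + c)^c}` — arbitrary degrees, multiplicities and cost, no torus
step on `h`, no distance hypothesis:

* `perDivisionHard_sigmaPiSigmaPi`.

It is the composition `perDivisionHard_sigmaPiSigmaPi_of` of skeleton v8.2 of line
`pair-descent-jss-endpoint` (`Cruxes/PerDivisionHard/Lines/pair_descent_jss_endpoint.lean`) with every
stub a landed theorem: a LARGE placed block `G(b,k) ⊕ M₀` (`n ≤ b⁴`) with a generic cut deciding
every atom (`stub_decidedAtoms`) → the fibre count `stub_sigmaPiSigmaPiCount` → the sparse-fibre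
rung `perDivisionHard_sparseFibre` (descent across scales).  It contains the atomic shape for
torus-homogeneous atoms (`J = L`, `L'_γ = {γ}`, `ν_{l,γ} = [l = γ]`), products of `≤ (log₂ n + c)^c`
two-term factors `∏_i (u_{i1} + u_{i2})` over sparse atoms, and powers `P^ν` of few-term atomic
expressions with `ν · log₂ |L'| ≤ (log₂ n + c)^c`.
-/

noncomputable section

-- `Summit.ValiantsHypothesis.ValiantsHypothesis.…` is the tree's mandated single-conjunct layout
-- (Sub = Summit), so the duplicated namespace component is intended.
set_option linter.dupNamespace false

namespace Summit.ValiantsHypothesis.ValiantsHypothesis.Theorems.DivisionGapPerDivisionHard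

open MvPolynomial Literature.Computability.AlgebraicComplexity
open Summit.ValiantsHypothesis.ValiantsHypothesis.Theorems.ZeroOneTransfer.Negative (topComponent)
open scoped NNReal

/-- **The `ΣΠΣΠ` rung of `PerDivisionHard`.**  For every `c` there are `e, n₀` such that for all
`n ≥ n₀` and every nonzero `ΣΠΣΠ` expression over a common pool of torus-homogeneous atoms with
`Σ_β |supp F_β|² ≤ 2^{⌊√n⌋/(log₂ n + e)^e}` and `Σ_l ∏_γ |L'_γ|^{ν_{l,γ}} ≤ 2^{(log₂ n + c)^c}`, the
pair inequality `2^{(log₂ n + c)^c} < L(per_n · h) + L(h)` holds.  Composition of the landed stubs of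
line `pair-descent-jss-endpoint` (seat c4). [folklore] -/
theorem perDivisionHard_sigmaPiSigmaPi :
    ∀ c : ℕ, ∃ e n₀ : ℕ, ∀ n ≥ n₀, ∀ (ι κ κ' θ : Type) (I : Finset ι) (L : Finset κ) (J : Finset θ)
      (L' : θ → Finset κ') (F : ι → MvPolynomial (Fin n × Fin n) ℝ≥0) (a : κ → ℝ≥0)
      (C : κ → (Fin n × Fin n) →₀ ℕ) (a' : θ → κ' → ℝ≥0) (C' : θ → κ' → (Fin n × Fin n) →₀ ℕ)
      (μ : θ → κ' → ι → ℕ) (ν : κ → θ → ℕ),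
      (∀ β ∈ I, IsTorusHomogeneous (F β)) →
      (∑ β ∈ I, (F β).support.card ^ 2) ≤ 2 ^ (Nat.sqrt n / (Nat.log 2 n + e) ^ e) →
      (∑ l ∈ L, a l • (monomial (C l) (1 : ℝ≥0) *
        ∏ γ ∈ J, (∑ l' ∈ L' γ, a' γ l' • (monomial (C' γ l') (1 : ℝ≥0) *
          ∏ β ∈ I, F β ^ μ γ l' β)) ^ ν l γ)) ≠ 0 →
      (∑ l ∈ L, ∏ γ ∈ J, (L' γ).card ^ ν l γ) ≤ 2 ^ ((Nat.log 2 n + c) ^ c) →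
      2 ^ ((Nat.log 2 n + c) ^ c) <
        complexity (perPoly (Fin n) ℝ≥0 * ∑ l ∈ L, a l • (monomial (C l) (1 : ℝ≥0) *
            ∏ γ ∈ J, (∑ l' ∈ L' γ, a' γ l' • (monomial (C' γ l') (1 : ℝ≥0) *
              ∏ β ∈ I, F β ^ μ γ l' β)) ^ ν l γ)) +
          complexity (∑ l ∈ L, a l • (monomial (C l) (1 : ℝ≥0) *
            ∏ γ ∈ J, (∑ l' ∈ L' γ, a' γ l' • (monomial (C' γ l') (1 : ℝ≥0) *
              ∏ β ∈ I, F β ^ μ γ l' β)) ^ ν l γ)) := by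
  intro c
  obtain ⟨e, n₁, hD⟩ := stub_decidedAtoms
  obtain ⟨n₂, hR⟩ := perDivisionHard_sparseFibre 4 c
  refine ⟨e, n₁ + n₂, ?_⟩
  intro n hn ι κ κ' θ I L J L' F a C a' C' μ ν hFtor hI hh hcount
  obtain ⟨b, k, m, eR, eC, w, hnb, hcut, hdec⟩ := hD n (by omega) ι I F hFtor hI
  have hfib := (stub_sigmaPiSigmaPiCount n ι κ κ' θ I L J L' F a C a' C' μ ν w hdec).trans hcount
  exact hR n (by omega) _ hh ⟨b, k, m, eR, eC, w, hcut, hnb, hfib⟩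

end Summit.ValiantsHypothesis.ValiantsHypothesis.Theorems.DivisionGapPerDivisionHard

end
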